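import Summits.QuantumFields.BalabanUV.Beta.FP.OneShotKKTTorus

/-!
# `BalabanUV.Beta.FP.OneShotKKTCriticalLine` — road «FP» for binder row D1, organisation γ, row **GAMMA-0** remainder («the `C²` LINE DATA of
# the constrained minimiser»): the binders `hγ` (a derivative CURVE near `t`) and `hγ₁` (its derivative at `t`) of `OneShotKKTTorus` §2 are
# DISCHARGED for the background line `s ↦ U(c₀ + s•v)` from an2's `ContDiffAt ℝ 2 U c₀` ALONE, and §2 ∘ §3 are composed into ONE statement:
# the second variation of the one shot along the minimiser line at `s = 0` is `KKTSecondVariation`'s six loops with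
# `Ḣ = DH_cov[𝓘v]`, `Q̇ = DQ[𝓘v]`, `Ḧ = D²H_cov[𝓘v,𝓘v] + DH_cov[D²U(c₀)[v,v]]`, `Q̈ = D²Q[𝓘v,𝓘v] + DQ[D²U(c₀)[v,v]]`

HONEST DEPENDENCY (cell records, verbatim): «continuum YM on T⁴ ⇐ BetaPertH ∧ nine spine estimates (0/9 proved); BetaPertH ⇐ (D1) ∧ (D4) ∧
CAP+tail; G-an2-4 gates asym, D1 and NE2/3/4.»  HONEST FRAMING (cell contract, verbatim): «discharging `BetaPertH` makes Bałaban's UV stability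
UNCONDITIONAL — a real constructive-QFT result; it is NOT the continuum limit and NOT the Clay problem.»  THIS MODULE is [folklore] Fréchet ∕
one-variable calculus (Mathlib `ContDiffAt.eventually`, `ContDiffAt.differentiableAt`, `ContDiffAt.fderiv_right`, `HasFDerivAt.comp_hasDerivAt`,
`HasDerivAt.clm_apply`, uniqueness of derivatives) composed BY NAME with leaf-05's `FP/OneShotKKTTorus.hasDerivAt_oneShot_comp_curve` (GAMMA-0 (a) ✓)
over ABSTRACT data `U, Hf, Qf`; the minimiser enters only through an2's `ContDiffAt ℝ 2 U c₀` + `HasFDerivAt U (mulVecCLM (minOp Hc C)) c₀`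
(`Beta/ConstrainedCriticalMap.exists_criticalMap` ✓, third and seventh conjuncts at `k = 2`).  NO estimate, NO lattice object, NO torus built,
nothing of Bałaban's manuscripts, no definition, no `def … : Prop`, nothing cited, 0 sorry.  It discharges NOTHING of `hbook`∕`hasym`∕D1.
NOT D1, NOT BetaPertH, NOT continuum, NOT Clay.

ABSOLUTE RULE (cell charter, verbatim): «No internally-minted statement may enter as a cited fact. Every hypothesis is either kernel-proved in this
package or a verbatim quotation of a PUBLISHED theorem with page reference. The manuscript(s) under audit are NOT citable for their own disputed
steps — they are the thing under adjudication; programme-internal (2001/route/tribunal) claims are never citable.»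

WHY (located in the cross-read C-ne9leaf08g30-1 of `OneShotKKTTorus`, GAPS.md, INFO-1).  §3 of that module supplies the VELOCITY `𝓘v` of the
minimiser line at ONE point, while §2 consumes a derivative CURVE `γ₁` near `t` and its derivative `w` at `t`; for `s ↦ U(c₀ + s•v)` both come
from `ContDiffAt ℝ 2 U c₀`: `γ₁ s := DU(c₀ + s•v)[v]` near `0`, `w := D²U(c₀)[v][v]` — this file does that packaging and nothing else.
CONTENT ([folklore]):
* §1 `hasDerivAt_affineLine` (`s ↦ c₀ + s•v` has derivative `v` everywhere), `eventually_hasFDerivAt_of_contDiffAt` (`C^2` at `c₀` ⟹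
  `HasFDerivAt U (DU y) y` for `y` near `c₀`), `hasFDerivAt_fderiv_of_contDiffAt_two` (`DU` has Fréchet derivative `D²U(c₀)` at `c₀`),
  **`eventually_hasDerivAt_line`** (the binder `hγ` of §2 for the line: `∀ᶠ s, HasDerivAt (s ↦ U(c₀+s•v)) (DU(c₀+s•v)[v]) s`),
  **`hasDerivAt_lineJet`** (the binder `hγ₁`: `s ↦ DU(c₀+s•v)[v]` has derivative `D²U(c₀)[v][v]` at `0`), `lineJet_zero_eq_minOp`
  (`DU(c₀)[v] = minOp Hc C *ᵥ v` from an2's derivative statement).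
* §2 **`hasDerivAt_oneShot_criticalMap_line`** — §2 ∘ §3 of `OneShotKKTTorus` along the minimiser line with the jets DISCHARGED: (i) near `s = 0`
  the one shot `−½log|det kkt(Hf(U(c₀+s•v)), Qf(U(c₀+s•v)))|` has derivative `−½tr(Γ·DHf[DU[v]]) − tr(𝓘·DQf[DU[v]])`; (ii) at `s = 0` that
  first variation has derivative the SIX LOOPS with `Ḣ = DHf(U c₀)[𝓘v]`, `Q̇ = DQf(U c₀)[𝓘v]`, `Ḧ = D²Hf[𝓘v,𝓘v] + DHf(U c₀)[D²U(c₀)[v,v]]`,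
  `Q̈` likewise (`𝓘 = minOp Hc C`); **`…_tadpole`** (regrouped: pure second jets + the `D²U(c₀)[v,v]`-tadpole displayed);
  **`…_of_tadpole_eq_zero`** — under the displayed `htad` for the fine acceleration (S4 on the road; at model level leaf-05's
  `TadpoleAdInvariance.tadpole_eq_zero_of_noInvariantCovector` ✓) the pure-jet six loops.
NOT HERE (honest): the identification of `U, Hf, Qf, Hc, C` with the road's torus objects, the blocking to level `j`, S4 ∕ Ad-invariance themselves,
GAMMA-7 ∕ ghost addends, any estimate.  0∕4 row-D1 binders touched.
Provenance: NE9 formalisation swarm leaf seat `b2b-balaban-t4-ne9-formalise-leaf-08` gen 30 (cross-cell idle-seat duty NE9 → β∕D1 road FP; the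
located INFO-1 of its own XREAD C-ne9leaf08g30-1), 2026-08-21; statement-first INTENT in the cell journal.
-/

noncomputable section

namespace Summit.QuantumFields.BalabanUV.Beta.FP.OneShotKKTCriticalLine

open Matrix Filter Topology
open Literature.MathematicalPhysics.QuantumFieldTheory.Balaban1983to89.Beta.Composition (kkt)
open Literature.MathematicalPhysics.QuantumFieldTheory.Balaban1983to89.Beta.CompositionSingular (flucCov minOp effForm)
open Summit.QuantumFields.BalabanUV.Beta.ConstrainedCriticalMap (mulVecCLM mulVecCLM_apply)
open Summit.QuantumFields.BalabanUV.Beta.FP.OneShotKKTTorus (hasDerivAt_comp_line hasDerivAt_oneShot_comp_curve)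

/-! ## §1 The `C²` line data of a map at a point -/

section LineData

variable {E F : Type*} [NormedAddCommGroup E] [NormedSpace ℝ E] [NormedAddCommGroup F] [NormedSpace ℝ F]

/-- [folklore] The affine line `s ↦ c₀ + s • v` has derivative `v` at every `s`. -/
theorem hasDerivAt_affineLine (c₀ v : E) (s : ℝ) : HasDerivAt (fun s : ℝ => c₀ + s • v) v s := by
  have h := ((hasDerivAt_id s).smul_const v).const_add c₀
  rwa [one_smul] at h

/-- [folklore] `C²` (indeed `C¹`) at `c₀` ⟹ `U` has Fréchet derivative `DU y` at every `y` near `c₀`. -/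
theorem eventually_hasFDerivAt_of_contDiffAt {U : E → F} {c₀ : E} (hU : ContDiffAt ℝ 2 U c₀) :
    ∀ᶠ y in 𝓝 c₀, HasFDerivAt U (fderiv ℝ U y) y := by
  filter_upwards [hU.eventually (by simp)] with y hy
  exact (hy.differentiableAt (by simp)).hasFDerivAt

/-- [folklore] `C²` at `c₀` ⟹ the derivative map `DU` has Fréchet derivative `D²U(c₀) := fderiv (fderiv U) c₀` at `c₀`. -/
theorem hasFDerivAt_fderiv_of_contDiffAt_two {U : E → F} {c₀ : E} (hU : ContDiffAt ℝ 2 U c₀) :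
    HasFDerivAt (fderiv ℝ U) (fderiv ℝ (fderiv ℝ U) c₀) c₀ := by
  have h1 : ContDiffAt ℝ 1 (fderiv ℝ U) c₀ := hU.fderiv_right (by norm_num)
  exact (h1.differentiableAt (by simp)).hasFDerivAt

/-- [folklore] **THE BINDER `hγ` FOR THE LINE**: `C²` at `c₀` ⟹ near `s = 0` the line map `s ↦ U (c₀ + s•v)` has derivative `DU(c₀ + s•v)[v]`. -/
theorem eventually_hasDerivAt_line {U : E → F} {c₀ : E} (hU : ContDiffAt ℝ 2 U c₀) (v : E) :
    ∀ᶠ s in 𝓝 (0 : ℝ), HasDerivAt (fun s : ℝ => U (c₀ + s • v)) (fderiv ℝ U (c₀ + s • v) v) s := by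
  have hline : Tendsto (fun s : ℝ => c₀ + s • v) (𝓝 0) (𝓝 c₀) := by
    have h := (hasDerivAt_affineLine c₀ v 0).continuousAt
    have e : c₀ + (0 : ℝ) • v = c₀ := by rw [zero_smul, add_zero]
    simpa [ContinuousAt, e] using h
  filter_upwards [hline.eventually (eventually_hasFDerivAt_of_contDiffAt hU)] with s hs
  exact hs.comp_hasDerivAt s (hasDerivAt_affineLine c₀ v s)

/-- [folklore] **THE BINDER `hγ₁` FOR THE LINE**: `C²` at `c₀` ⟹ the first-jet curve `s ↦ DU(c₀ + s•v)[v]` has derivative `D²U(c₀)[v][v]` at `0`. -/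
theorem hasDerivAt_lineJet {U : E → F} {c₀ : E} (hU : ContDiffAt ℝ 2 U c₀) (v : E) :
    HasDerivAt (fun s : ℝ => fderiv ℝ U (c₀ + s • v) v) ((fderiv ℝ (fderiv ℝ U) c₀ v) v) 0 := by
  have hc : HasDerivAt (fun s : ℝ => fderiv ℝ U (c₀ + s • v)) (fderiv ℝ (fderiv ℝ U) c₀ v) 0 :=
    hasDerivAt_comp_line (hasFDerivAt_fderiv_of_contDiffAt_two hU) v
  have h := hc.clm_apply (hasDerivAt_const (0 : ℝ) v)
  simpa using h

/-- [folklore] With an2's derivative statement `HasFDerivAt U (mulVecCLM (minOp Hc C)) c₀` the line jet at `0` is `DU(c₀)[v] = minOp Hc C *ᵥ v`. -/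
theorem lineJet_zero_eq_minOp {κ μ : Type*} [Fintype κ] [Fintype μ] [DecidableEq κ] [DecidableEq μ] {U : (μ → ℝ) → (κ → ℝ)}
    {Hc : Matrix κ κ ℝ} {C : Matrix μ κ ℝ} {c₀ : μ → ℝ} (hUd : HasFDerivAt U (mulVecCLM (minOp Hc C)) c₀) (v : μ → ℝ) :
    fderiv ℝ U (c₀ + (0 : ℝ) • v) v = minOp Hc C *ᵥ v := by
  rw [zero_smul, add_zero, hUd.fderiv, mulVecCLM_apply]

end LineData

/-! ## §2 The one shot along the minimiser line, jets discharged -/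

section CriticalLine

variable {κ μ ν ρ : Type*} [Fintype κ] [Fintype μ] [Fintype ν] [Fintype ρ] [DecidableEq κ] [DecidableEq μ] [DecidableEq ν] [DecidableEq ρ]

/-- [folklore] **THE ONE SHOT ALONG THE MINIMISER LINE — `OneShotKKTTorus` §2 ∘ §3 WITH THE `C²` LINE DATA DISCHARGED.**  Data: an2's constrained
critical map `U` with `ContDiffAt ℝ 2 U c₀` and `HasFDerivAt U (mulVecCLM (minOp Hc C)) c₀` (`exists_criticalMap`, `k = 2`); ABSTRACT `C²` maps
`Hf` («`H_cov`», symmetric near `U c₀`), `Qf` («`Q_U`») with Fréchet jets near `U c₀` and second jets at `U c₀`; `kkt` non-degenerate at `U c₀`.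
Then along `s ↦ U(c₀ + s•v)`: (i) near `s = 0` the one shot has derivative `−½tr(Γ·DHf[DU[v]]) − tr(𝓘·DQf[DU[v]])`; (ii) at `s = 0` that first
variation has derivative the SIX LOOPS of `KKTSecondVariation` with `Ḣ = DHf(U c₀)[𝓘v]`, `Q̇ = DQf(U c₀)[𝓘v]`,
`Ḧ = D²Hf[𝓘v][𝓘v] + DHf(U c₀)[D²U(c₀)[v][v]]`, `Q̈ = D²Qf[𝓘v][𝓘v] + DQf(U c₀)[D²U(c₀)[v][v]]`, `𝓘v = minOp Hc C *ᵥ v`. -/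
theorem hasDerivAt_oneShot_criticalMap_line {U : (μ → ℝ) → (κ → ℝ)} {Hc : Matrix κ κ ℝ} {C : Matrix μ κ ℝ} {c₀ v : μ → ℝ}
    {Hf : (κ → ℝ) → ν → ν → ℝ} {dHf : (κ → ℝ) → ((κ → ℝ) →L[ℝ] (ν → ν → ℝ))} {d2Hf : (κ → ℝ) →L[ℝ] (κ → ℝ) →L[ℝ] (ν → ν → ℝ)}
    {Qf : (κ → ℝ) → ρ → ν → ℝ} {dQf : (κ → ℝ) → ((κ → ℝ) →L[ℝ] (ρ → ν → ℝ))} {d2Qf : (κ → ℝ) →L[ℝ] (κ → ℝ) →L[ℝ] (ρ → ν → ℝ)}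
    (hU2 : ContDiffAt ℝ 2 U c₀) (hUd : HasFDerivAt U (mulVecCLM (minOp Hc C)) c₀)
    (hH : ∀ᶠ x in 𝓝 (U c₀), HasFDerivAt Hf (dHf x) x) (hdH : HasFDerivAt dHf d2Hf (U c₀))
    (hQ : ∀ᶠ x in 𝓝 (U c₀), HasFDerivAt Qf (dQf x) x) (hdQ : HasFDerivAt dQf d2Qf (U c₀))
    (hsym : ∀ᶠ x in 𝓝 (U c₀), (Matrix.of (Hf x))ᵀ = Matrix.of (Hf x))
    (hdet : (kkt (Matrix.of (Hf (U c₀))) (Matrix.of (Qf (U c₀)))).det ≠ 0) :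
    (∀ᶠ s in 𝓝 (0 : ℝ), HasDerivAt
        (fun s : ℝ => -(1 / 2 : ℝ) * Real.log |(kkt (Matrix.of (Hf (U (c₀ + s • v)))) (Matrix.of (Qf (U (c₀ + s • v))))).det|)
        (-(1 / 2 : ℝ) * (flucCov (Matrix.of (Hf (U (c₀ + s • v)))) (Matrix.of (Qf (U (c₀ + s • v))))
              * Matrix.of (dHf (U (c₀ + s • v)) (fderiv ℝ U (c₀ + s • v) v))).trace
          - (minOp (Matrix.of (Hf (U (c₀ + s • v)))) (Matrix.of (Qf (U (c₀ + s • v))))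
              * Matrix.of (dQf (U (c₀ + s • v)) (fderiv ℝ U (c₀ + s • v) v))).trace) s)
    ∧ HasDerivAt
        (fun s : ℝ => -(1 / 2 : ℝ) * (flucCov (Matrix.of (Hf (U (c₀ + s • v)))) (Matrix.of (Qf (U (c₀ + s • v))))
              * Matrix.of (dHf (U (c₀ + s • v)) (fderiv ℝ U (c₀ + s • v) v))).trace
          - (minOp (Matrix.of (Hf (U (c₀ + s • v)))) (Matrix.of (Qf (U (c₀ + s • v))))
              * Matrix.of (dQf (U (c₀ + s • v)) (fderiv ℝ U (c₀ + s • v) v))).trace)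
        ((1 / 2 : ℝ) * (flucCov (Matrix.of (Hf (U c₀))) (Matrix.of (Qf (U c₀))) * Matrix.of (dHf (U c₀) (minOp Hc C *ᵥ v))
              * (flucCov (Matrix.of (Hf (U c₀))) (Matrix.of (Qf (U c₀))) * Matrix.of (dHf (U c₀) (minOp Hc C *ᵥ v)))).trace
          - (1 / 2 : ℝ) * (flucCov (Matrix.of (Hf (U c₀))) (Matrix.of (Qf (U c₀)))
              * Matrix.of (d2Hf (minOp Hc C *ᵥ v) (minOp Hc C *ᵥ v) + dHf (U c₀) ((fderiv ℝ (fderiv ℝ U) c₀ v) v))).trace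
          + 2 * (flucCov (Matrix.of (Hf (U c₀))) (Matrix.of (Qf (U c₀))) * Matrix.of (dHf (U c₀) (minOp Hc C *ᵥ v))
              * (minOp (Matrix.of (Hf (U c₀))) (Matrix.of (Qf (U c₀))) * Matrix.of (dQf (U c₀) (minOp Hc C *ᵥ v)))).trace
          + (minOp (Matrix.of (Hf (U c₀))) (Matrix.of (Qf (U c₀))) * Matrix.of (dQf (U c₀) (minOp Hc C *ᵥ v))
              * (minOp (Matrix.of (Hf (U c₀))) (Matrix.of (Qf (U c₀))) * Matrix.of (dQf (U c₀) (minOp Hc C *ᵥ v)))).trace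
          - (effForm (Matrix.of (Hf (U c₀))) (Matrix.of (Qf (U c₀)))
              * (Matrix.of (dQf (U c₀) (minOp Hc C *ᵥ v))
                * (flucCov (Matrix.of (Hf (U c₀))) (Matrix.of (Qf (U c₀))) * (Matrix.of (dQf (U c₀) (minOp Hc C *ᵥ v)))ᵀ))).trace
          - (minOp (Matrix.of (Hf (U c₀))) (Matrix.of (Qf (U c₀)))
              * Matrix.of (d2Qf (minOp Hc C *ᵥ v) (minOp Hc C *ᵥ v) + dQf (U c₀) ((fderiv ℝ (fderiv ℝ U) c₀ v) v))).trace) 0 := by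
  -- the line, its jets
  have hγ := eventually_hasDerivAt_line hU2 v
  have hγ₁ := hasDerivAt_lineJet hU2 v
  have e0 : c₀ + (0 : ℝ) • v = c₀ := by rw [zero_smul, add_zero]
  have eU : U (c₀ + (0 : ℝ) • v) = U c₀ := by rw [e0]
  have eJ : fderiv ℝ U (c₀ + (0 : ℝ) • v) v = minOp Hc C *ᵥ v := lineJet_zero_eq_minOp hUd v
  -- transport the data at `U c₀` to `γ 0 = U (c₀ + 0•v)`
  have hH' : ∀ᶠ x in 𝓝 (U (c₀ + (0 : ℝ) • v)), HasFDerivAt Hf (dHf x) x := by rw [eU]; exact hH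
  have hdH' : HasFDerivAt dHf d2Hf (U (c₀ + (0 : ℝ) • v)) := by rw [eU]; exact hdH
  have hQ' : ∀ᶠ x in 𝓝 (U (c₀ + (0 : ℝ) • v)), HasFDerivAt Qf (dQf x) x := by rw [eU]; exact hQ
  have hdQ' : HasFDerivAt dQf d2Qf (U (c₀ + (0 : ℝ) • v)) := by rw [eU]; exact hdQ
  have hsym' : ∀ᶠ x in 𝓝 (U (c₀ + (0 : ℝ) • v)), (Matrix.of (Hf x))ᵀ = Matrix.of (Hf x) := by rw [eU]; exact hsym
  have hdet' : (kkt (Matrix.of (Hf (U (c₀ + (0 : ℝ) • v)))) (Matrix.of (Qf (U (c₀ + (0 : ℝ) • v))))).det ≠ 0 := by rw [eU]; exact hdet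
  have h := hasDerivAt_oneShot_comp_curve (γ := fun s : ℝ => U (c₀ + s • v)) (γ₁ := fun s : ℝ => fderiv ℝ U (c₀ + s • v) v)
    (t := 0) hγ hγ₁ hH' hdH' hQ' hdQ' hsym' hdet'
  refine ⟨h.1, ?_⟩
  have h2 := h.2
  simp only [eU, eJ] at h2
  exact h2

/-- [folklore] **THE `D²U`-TADPOLE DISPLAYED**: the same second variation regrouped as (six loops with the PURE second jets `D²Hf[𝓘v][𝓘v]`,
`D²Qf[𝓘v][𝓘v]`) `+` (the tadpole of the fine acceleration `D²U(c₀)[v][v]`: `−½tr(Γ·DHf(U c₀)[D²U(c₀)[v][v]]) − tr(𝓘·DQf(U c₀)[D²U(c₀)[v][v]])`). -/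
theorem hasDerivAt_oneShot_criticalMap_line_tadpole {U : (μ → ℝ) → (κ → ℝ)} {Hc : Matrix κ κ ℝ} {C : Matrix μ κ ℝ} {c₀ v : μ → ℝ}
    {Hf : (κ → ℝ) → ν → ν → ℝ} {dHf : (κ → ℝ) → ((κ → ℝ) →L[ℝ] (ν → ν → ℝ))} {d2Hf : (κ → ℝ) →L[ℝ] (κ → ℝ) →L[ℝ] (ν → ν → ℝ)}
    {Qf : (κ → ℝ) → ρ → ν → ℝ} {dQf : (κ → ℝ) → ((κ → ℝ) →L[ℝ] (ρ → ν → ℝ))} {d2Qf : (κ → ℝ) →L[ℝ] (κ → ℝ) →L[ℝ] (ρ → ν → ℝ)}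
    (hU2 : ContDiffAt ℝ 2 U c₀) (hUd : HasFDerivAt U (mulVecCLM (minOp Hc C)) c₀)
    (hH : ∀ᶠ x in 𝓝 (U c₀), HasFDerivAt Hf (dHf x) x) (hdH : HasFDerivAt dHf d2Hf (U c₀))
    (hQ : ∀ᶠ x in 𝓝 (U c₀), HasFDerivAt Qf (dQf x) x) (hdQ : HasFDerivAt dQf d2Qf (U c₀))
    (hsym : ∀ᶠ x in 𝓝 (U c₀), (Matrix.of (Hf x))ᵀ = Matrix.of (Hf x))
    (hdet : (kkt (Matrix.of (Hf (U c₀))) (Matrix.of (Qf (U c₀)))).det ≠ 0) :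
    HasDerivAt
        (fun s : ℝ => -(1 / 2 : ℝ) * (flucCov (Matrix.of (Hf (U (c₀ + s • v)))) (Matrix.of (Qf (U (c₀ + s • v))))
              * Matrix.of (dHf (U (c₀ + s • v)) (fderiv ℝ U (c₀ + s • v) v))).trace
          - (minOp (Matrix.of (Hf (U (c₀ + s • v)))) (Matrix.of (Qf (U (c₀ + s • v))))
              * Matrix.of (dQf (U (c₀ + s • v)) (fderiv ℝ U (c₀ + s • v) v))).trace)
        ((1 / 2 : ℝ) * (flucCov (Matrix.of (Hf (U c₀))) (Matrix.of (Qf (U c₀))) * Matrix.of (dHf (U c₀) (minOp Hc C *ᵥ v))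
              * (flucCov (Matrix.of (Hf (U c₀))) (Matrix.of (Qf (U c₀))) * Matrix.of (dHf (U c₀) (minOp Hc C *ᵥ v)))).trace
          - (1 / 2 : ℝ) * (flucCov (Matrix.of (Hf (U c₀))) (Matrix.of (Qf (U c₀)))
              * Matrix.of (d2Hf (minOp Hc C *ᵥ v) (minOp Hc C *ᵥ v))).trace
          + 2 * (flucCov (Matrix.of (Hf (U c₀))) (Matrix.of (Qf (U c₀))) * Matrix.of (dHf (U c₀) (minOp Hc C *ᵥ v))
              * (minOp (Matrix.of (Hf (U c₀))) (Matrix.of (Qf (U c₀))) * Matrix.of (dQf (U c₀) (minOp Hc C *ᵥ v)))).trace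
          + (minOp (Matrix.of (Hf (U c₀))) (Matrix.of (Qf (U c₀))) * Matrix.of (dQf (U c₀) (minOp Hc C *ᵥ v))
              * (minOp (Matrix.of (Hf (U c₀))) (Matrix.of (Qf (U c₀))) * Matrix.of (dQf (U c₀) (minOp Hc C *ᵥ v)))).trace
          - (effForm (Matrix.of (Hf (U c₀))) (Matrix.of (Qf (U c₀)))
              * (Matrix.of (dQf (U c₀) (minOp Hc C *ᵥ v))
                * (flucCov (Matrix.of (Hf (U c₀))) (Matrix.of (Qf (U c₀))) * (Matrix.of (dQf (U c₀) (minOp Hc C *ᵥ v)))ᵀ))).trace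
          - (minOp (Matrix.of (Hf (U c₀))) (Matrix.of (Qf (U c₀)))
              * Matrix.of (d2Qf (minOp Hc C *ᵥ v) (minOp Hc C *ᵥ v))).trace
          + (-(1 / 2 : ℝ) * (flucCov (Matrix.of (Hf (U c₀))) (Matrix.of (Qf (U c₀)))
                * Matrix.of (dHf (U c₀) ((fderiv ℝ (fderiv ℝ U) c₀ v) v))).trace
              - (minOp (Matrix.of (Hf (U c₀))) (Matrix.of (Qf (U c₀)))
                * Matrix.of (dQf (U c₀) ((fderiv ℝ (fderiv ℝ U) c₀ v) v))).trace)) 0 := by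
  refine (hasDerivAt_oneShot_criticalMap_line hU2 hUd hH hdH hQ hdQ hsym hdet).2.congr_deriv ?_
  rw [← Matrix.of_add_of, ← Matrix.of_add_of, Matrix.mul_add, Matrix.mul_add, Matrix.trace_add, Matrix.trace_add]
  ring

/-- [folklore] **… AND UNDER THE TADPOLE HYPOTHESIS FOR THE FINE ACCELERATION `D²U(c₀)[v][v]`** (S4 on the road; at model level leaf-05's
`TadpoleAdInvariance.tadpole_eq_zero_of_noInvariantCovector` ✓ supplies it for EVERY fine direction): the second variation along the minimiser
line at `s = 0` is the six loops with the PURE second jets `D²Hf[𝓘v][𝓘v]`, `D²Qf[𝓘v][𝓘v]`. -/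
theorem hasDerivAt_oneShot_criticalMap_line_of_tadpole_eq_zero {U : (μ → ℝ) → (κ → ℝ)} {Hc : Matrix κ κ ℝ} {C : Matrix μ κ ℝ}
    {c₀ v : μ → ℝ}
    {Hf : (κ → ℝ) → ν → ν → ℝ} {dHf : (κ → ℝ) → ((κ → ℝ) →L[ℝ] (ν → ν → ℝ))} {d2Hf : (κ → ℝ) →L[ℝ] (κ → ℝ) →L[ℝ] (ν → ν → ℝ)}
    {Qf : (κ → ℝ) → ρ → ν → ℝ} {dQf : (κ → ℝ) → ((κ → ℝ) →L[ℝ] (ρ → ν → ℝ))} {d2Qf : (κ → ℝ) →L[ℝ] (κ → ℝ) →L[ℝ] (ρ → ν → ℝ)}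
    (hU2 : ContDiffAt ℝ 2 U c₀) (hUd : HasFDerivAt U (mulVecCLM (minOp Hc C)) c₀)
    (hH : ∀ᶠ x in 𝓝 (U c₀), HasFDerivAt Hf (dHf x) x) (hdH : HasFDerivAt dHf d2Hf (U c₀))
    (hQ : ∀ᶠ x in 𝓝 (U c₀), HasFDerivAt Qf (dQf x) x) (hdQ : HasFDerivAt dQf d2Qf (U c₀))
    (hsym : ∀ᶠ x in 𝓝 (U c₀), (Matrix.of (Hf x))ᵀ = Matrix.of (Hf x))
    (hdet : (kkt (Matrix.of (Hf (U c₀))) (Matrix.of (Qf (U c₀)))).det ≠ 0)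
    (htad : (-(1 / 2 : ℝ) * (flucCov (Matrix.of (Hf (U c₀))) (Matrix.of (Qf (U c₀)))
              * Matrix.of (dHf (U c₀) ((fderiv ℝ (fderiv ℝ U) c₀ v) v))).trace
            - (minOp (Matrix.of (Hf (U c₀))) (Matrix.of (Qf (U c₀))) * Matrix.of (dQf (U c₀) ((fderiv ℝ (fderiv ℝ U) c₀ v) v))).trace) = 0) :
    HasDerivAt
        (fun s : ℝ => -(1 / 2 : ℝ) * (flucCov (Matrix.of (Hf (U (c₀ + s • v)))) (Matrix.of (Qf (U (c₀ + s • v))))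
              * Matrix.of (dHf (U (c₀ + s • v)) (fderiv ℝ U (c₀ + s • v) v))).trace
          - (minOp (Matrix.of (Hf (U (c₀ + s • v)))) (Matrix.of (Qf (U (c₀ + s • v))))
              * Matrix.of (dQf (U (c₀ + s • v)) (fderiv ℝ U (c₀ + s • v) v))).trace)
        ((1 / 2 : ℝ) * (flucCov (Matrix.of (Hf (U c₀))) (Matrix.of (Qf (U c₀))) * Matrix.of (dHf (U c₀) (minOp Hc C *ᵥ v))
              * (flucCov (Matrix.of (Hf (U c₀))) (Matrix.of (Qf (U c₀))) * Matrix.of (dHf (U c₀) (minOp Hc C *ᵥ v)))).trace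
          - (1 / 2 : ℝ) * (flucCov (Matrix.of (Hf (U c₀))) (Matrix.of (Qf (U c₀)))
              * Matrix.of (d2Hf (minOp Hc C *ᵥ v) (minOp Hc C *ᵥ v))).trace
          + 2 * (flucCov (Matrix.of (Hf (U c₀))) (Matrix.of (Qf (U c₀))) * Matrix.of (dHf (U c₀) (minOp Hc C *ᵥ v))
              * (minOp (Matrix.of (Hf (U c₀))) (Matrix.of (Qf (U c₀))) * Matrix.of (dQf (U c₀) (minOp Hc C *ᵥ v)))).trace
          + (minOp (Matrix.of (Hf (U c₀))) (Matrix.of (Qf (U c₀))) * Matrix.of (dQf (U c₀) (minOp Hc C *ᵥ v))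
              * (minOp (Matrix.of (Hf (U c₀))) (Matrix.of (Qf (U c₀))) * Matrix.of (dQf (U c₀) (minOp Hc C *ᵥ v)))).trace
          - (effForm (Matrix.of (Hf (U c₀))) (Matrix.of (Qf (U c₀)))
              * (Matrix.of (dQf (U c₀) (minOp Hc C *ᵥ v))
                * (flucCov (Matrix.of (Hf (U c₀))) (Matrix.of (Qf (U c₀))) * (Matrix.of (dQf (U c₀) (minOp Hc C *ᵥ v)))ᵀ))).trace
          - (minOp (Matrix.of (Hf (U c₀))) (Matrix.of (Qf (U c₀)))
              * Matrix.of (d2Qf (minOp Hc C *ᵥ v) (minOp Hc C *ᵥ v))).trace) 0 := by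
  refine (hasDerivAt_oneShot_criticalMap_line_tadpole hU2 hUd hH hdH hQ hdQ hsym hdet).congr_deriv ?_
  rw [htad, add_zero]

end CriticalLine

end Summit.QuantumFields.BalabanUV.Beta.FP.OneShotKKTCriticalLine

end
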